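import Mathlib
import Summits.Ventures.PercRepro2.Defs
import Summits.Ventures.PercRepro2.Independence
import Summits.Ventures.PercRepro2.Harris
import Summits.Ventures.PercRepro2.Graph
import Summits.Ventures.PercRepro2.Exploration
import Summits.Ventures.PercRepro2.Events
import Summits.Ventures.PercRepro2.Induced
import Summits.Ventures.PercRepro2.BHK
import Summits.Ventures.PercRepro2.BHKEvents
import Summits.Ventures.PercRepro2.RBRoot
import Summits.Ventures.PercRepro2.RBDefs
import Summits.Ventures.PercRepro2.RBClubDefs
import Summits.Ventures.PercRepro2.RBClubPoly
import Summits.Ventures.PercRepro2.RBClubTwoMarkers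
import Summits.Ventures.PercRepro2.RBClubTwoMarkersMain
import Summits.Ventures.PercRepro2.RBClubKernel

/-!
# The coarse row at a root or a marker, and at every vertex with `N⁺(w) ⊆ {s, t, b, o}`
(blind cell PercRepro2, mine-a g8; MINE-A.md §45, §49)

`RB.Club` at `w ∈ {s, t, b, o}`: at `w = s` the event `{s ↔ w}` is sure and the coarse row is
BHK 1.3; at `w = t` it is null under `Q` and the coarse row is an equality; at `w = b` (resp. `o`)
`{s ↔ w} = {b ↔ s}` (resp. `{o ↔ s}`) and the coarse row is again BHK 1.3. `RB.Club_of_nbhd` combines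
these with the kernel theorem `RB.Club_of_nbhd'`: the coarse row holds at EVERY vertex all of whose
nonzero-weight edges end in `{s, t, b, o}`.
-/

namespace Summit.Ventures.PercRepro2

namespace RB

open scoped Classical

variable {V : Type*} {E : Type*} [Fintype E] [DecidableEq E] [Fintype V] [DecidableEq V]
  {R : Type*} [Field R] [LinearOrder R] [IsStrictOrderedRing R]

omit [DecidableEq V] in
/-- The coarse row from BHK 1.3 once the `{s ↔ w}`-part of the masses is the whole mass: if
`P(Q ∩ Mᶜ ∩ bL) = 0` and `P(Q ∩ M ∩ bL ∩ oL) = P(Q ∩ bL ∩ oL)`, then `Club`. -/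
lemma Club_of_sure {p : E → R} (hp : IsProbVec p) (ends : E → Sym2 V) (o b s t w : V)
    (h0 : prob p (Qst ends s t ∩ (connEvent ends s w)ᶜ ∩ connEvent ends b s) = 0)
    (h1 : prob p (Qst ends s t ∩ connEvent ends s w ∩ connEvent ends b s ∩ connEvent ends o s) =
      prob p (Qst ends s t ∩ connEvent ends b s ∩ connEvent ends o s)) :
    Club p ends o b s t w := by
  unfold Club
  rw [h0, h1, zero_mul, zero_div, add_zero]
  unfold Qst
  exact RBRoot.same_collapsed ends hp o b s t

omit [DecidableEq V] in
/-- **The coarse row at `w = s`**: BHK 1.3. -/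
theorem Club_at_s {p : E → R} (hp : IsProbVec p) (ends : E → Sym2 V) (o b s t : V) :
    Club p ends o b s t s := by
  refine Club_of_sure hp ends o b s t s ?_ ?_
  · have h : Qst ends s t ∩ (connEvent ends s s)ᶜ ∩ connEvent ends b s = ∅ :=
      Set.eq_empty_iff_forall_notMem.2 fun ω ⟨⟨_, hns⟩, _⟩ => hns (conn_refl _ _ _)
    rw [h, prob_empty]
  · congr 1
    ext ω
    simp only [Set.mem_inter_iff, mem_connEvent]
    exact ⟨fun ⟨⟨⟨hQ, _⟩, hb⟩, ho⟩ => ⟨⟨hQ, hb⟩, ho⟩,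
      fun ⟨⟨hQ, hb⟩, ho⟩ => ⟨⟨⟨hQ, conn_refl _ _ _⟩, hb⟩, ho⟩⟩

omit [Fintype V] [DecidableEq V] [IsStrictOrderedRing R] in
/-- **The coarse row at `w = t`**: `{s ↔ t}` is null under `Q`, the coarse row is an equality. -/
theorem Club_at_t {p : E → R} (ends : E → Sym2 V) (o b s t : V) :
    Club p ends o b s t t := by
  unfold Club
  have h : Qst ends s t ∩ connEvent ends s t ∩ connEvent ends b s ∩ connEvent ends o s = ∅ :=
    Set.eq_empty_iff_forall_notMem.2 fun ω ⟨⟨⟨hQ, hst⟩, _⟩, _⟩ => hQ hst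
  have e : ∀ X : Set (Config E), Qst ends s t ∩ (connEvent ends s t)ᶜ ∩ X = Qst ends s t ∩ X := by
    intro X
    ext ω
    simp only [Set.mem_inter_iff, Set.mem_compl_iff, mem_connEvent, Qst]
    exact ⟨fun ⟨⟨hQ, _⟩, hX⟩ => ⟨hQ, hX⟩, fun ⟨hQ, hX⟩ => ⟨⟨hQ, hQ⟩, hX⟩⟩
  have e' : Qst ends s t ∩ (connEvent ends s t)ᶜ = Qst ends s t := by
    have := e Set.univ
    rwa [Set.inter_univ, Set.inter_univ] at this
  rw [h, prob_empty, zero_add, e, e, e']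

omit [DecidableEq V] in
/-- **The coarse row at `w = b`**: `{s ↔ b} = {b ↔ s}`, BHK 1.3. -/
theorem Club_at_b {p : E → R} (hp : IsProbVec p) (ends : E → Sym2 V) (o b s t : V) :
    Club p ends o b s t b := by
  refine Club_of_sure hp ends o b s t b ?_ ?_
  · have h : Qst ends s t ∩ (connEvent ends s b)ᶜ ∩ connEvent ends b s = ∅ :=
      Set.eq_empty_iff_forall_notMem.2 fun ω ⟨⟨_, hns⟩, hbs⟩ => hns (conn_symm hbs)
    rw [h, prob_empty]
  · congr 1
    ext ω
    simp only [Set.mem_inter_iff, mem_connEvent]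
    exact ⟨fun ⟨⟨⟨hQ, _⟩, hb⟩, ho⟩ => ⟨⟨hQ, hb⟩, ho⟩,
      fun ⟨⟨hQ, hb⟩, ho⟩ => ⟨⟨⟨hQ, conn_symm hb⟩, hb⟩, ho⟩⟩

omit [DecidableEq V] in
/-- **The coarse row at `w = o`**: by the symmetry of the coarse row in the markers. -/
theorem Club_at_o {p : E → R} (hp : IsProbVec p) (ends : E → Sym2 V) (o b s t : V) :
    Club p ends o b s t o :=
  (RBClubKernel.club_comm ends s t o p o b).2 (Club_at_b hp ends b o s t)

omit [DecidableEq V] in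
/-- **The coarse row at every root and marker.** -/
theorem Club_of_mem {p : E → R} (hp : IsProbVec p) (ends : E → Sym2 V) (o b s t w : V)
    (hw : w = s ∨ w = t ∨ w = b ∨ w = o) : Club p ends o b s t w := by
  rcases hw with rfl | rfl | rfl | rfl
  · exact Club_at_s hp ends o b w t
  · exact Club_at_t ends o b s w
  · exact Club_at_b hp ends o w s t
  · exact Club_at_o hp ends w b s t

/-- **THEOREM 2′RB-CLUB-K at every vertex `w` with `N⁺(w) ⊆ {s, t, b, o}`**: a root, a marker
(`Club_of_mem`) or a kernel third vertex (`Club_of_nbhd'`). -/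
theorem Club_of_nbhd {p : E → R} (hp : IsProbVec p) (ends : E → Sym2 V) (o b s t w : V)
    (H : ∀ e, w ∈ ends e → p e ≠ 0 →
      ends e = s(w, s) ∨ ends e = s(w, t) ∨ ends e = s(w, b) ∨ ends e = s(w, o)) :
    Club p ends o b s t w := by
  by_cases hw : w = s ∨ w = t ∨ w = b ∨ w = o
  · exact Club_of_mem hp ends o b s t w hw
  · exact Club_of_nbhd' hp ends o b s t w H (fun h => hw (Or.inl h.symm))
      (fun h => hw (Or.inr (Or.inl h.symm))) (fun h => hw (Or.inr (Or.inr (Or.inl h.symm))))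
      (fun h => hw (Or.inr (Or.inr (Or.inr h.symm))))

end RB

end Summit.Ventures.PercRepro2
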